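import Summits.ValiantsHypothesis.ValiantsHypothesis.Theorems.SymPencilPerFourPairingDiscTools

/-!
# Route `SymPencil` — the pairing discriminant on a six-dimensional two-row space, PRODUCT CASE
# tools: hyperplanes of `K⁴`, unit vectors, and the `Fin 4` combinatorics
# (towards leaf 5 `stub_twoLineFilter`; `--supports` stmt-ValiantsHypothesis-5674
# `SdcSuperquadratic`; rung currency only, nothing here bears on `VP ≠ VNP`)

For a `3`-dimensional `A ≤ K⁴` say `P l` (witness `i ≠ l`) if `A ∩ {a_l = 0} ⊆ {a_i = 0}`.  Then
`e_k ∈ A` for `k ∉ {i, l}` and `e_i ∉ A` (`single_mem_of_P`); the finite combinatorics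
(`combQ`, `combP`, by `decide` on `Fin 4`): `P` cannot hold for all four `l` on a proper subspace
(`false_of_P_all`), and `Q j` for the three `j ≠ l` forces `e_k ∈ B` for all `k ≠ l`, i.e.
`B = {b_l = 0}` (`coord_vanish_of_Q`, `coord_vanish_of_singles`).  Used by
`SymPencilPerFourPairingDiscSixProduct`.

Honest framing: lemmas; `27 ≤ sdc(per₄) ≤ 29` unchanged, stmt-5674 open, `VP ≠ VNP` not moved, no
summit statement is proved here.  No definitions, no named facts. [folklore]
-/

noncomputable section

-- single-conjunct layout: Sub = Summit, duplicated namespace component intended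
set_option linter.dupNamespace false

namespace Summit.ValiantsHypothesis.ValiantsHypothesis.Theorems.SymPencilPerFourPairingDiscSixProductTools

open Matrix Finset Module Polynomial
open Literature.Computability.AlgebraicComplexity.AlperBogartVelasco
open Summit.ValiantsHypothesis.ValiantsHypothesis.Theorems.SymPencilPerFourPairingHyperplane
open Summit.ValiantsHypothesis.ValiantsHypothesis.Theorems.SymPencilPerFourPairingDiscTools

variable {K : Type*} [Field K]

/-! ### Finite combinatorics on `Fin 4` -/

/-- If for every `j ≠ l` there is `i ≠ j` outside `S` with `{i, j}ᶜ ⊆ S`, and `S ≠ univ`, then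
`S ⊇ {l}ᶜ`. [folklore] -/
theorem combQ : ∀ (l : Fin 4) (s0 s1 s2 s3 : Bool),
    (∃ k, ![s0, s1, s2, s3] k = false) →
    (∀ j, j ≠ l → ∃ i, i ≠ j ∧ ![s0, s1, s2, s3] i = false ∧
      ∀ k, k ≠ i → k ≠ j → ![s0, s1, s2, s3] k = true) →
    ∀ k, k ≠ l → ![s0, s1, s2, s3] k = true := by
  decide

/-- The same condition for ALL `j` is inconsistent with `S ≠ univ`. [folklore] -/
theorem combP : ∀ (s0 s1 s2 s3 : Bool),
    (∃ k, ![s0, s1, s2, s3] k = false) →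
    ¬ (∀ j : Fin 4, ∃ i, i ≠ j ∧ ![s0, s1, s2, s3] i = false ∧
      ∀ k, k ≠ i → k ≠ j → ![s0, s1, s2, s3] k = true) := by
  decide

/-! ### Hyperplanes of `K⁴` and unit vectors -/

/-- A subspace of `K⁴` on which two coordinates vanish has dimension `≤ 2`. [folklore] -/
theorem finrank_le_two_of_pair_vanish (U : Submodule K (Fin 4 → K)) {m m' : Fin 4}
    (hmm : m ≠ m') (h : ∀ u ∈ U, u m = 0 ∧ u m' = 0) : finrank K U ≤ 2 := by
  classical
  let ψ : (Fin 4 → K) →ₗ[K] (Fin 2 → K) :=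
    LinearMap.pi fun i => LinearMap.proj (![m, m'] i)
  have hψ : ∀ b i, ψ b i = b (![m, m'] i) := fun _ _ => rfl
  have hsurj : Function.Surjective ψ := by
    intro c
    refine ⟨Pi.single m (c 0) + Pi.single m' (c 1), ?_⟩
    funext i
    fin_cases i
    · simp [hψ, hmm]
    · simp [hψ, hmm.symm]
  have hker : finrank K (LinearMap.ker ψ) = 2 := by
    have h := LinearMap.finrank_range_add_finrank_ker ψ
    rw [LinearMap.range_eq_top.2 hsurj, finrank_top, Module.finrank_fintype_fun_eq_card,
      Fintype.card_fin, Module.finrank_fintype_fun_eq_card, Fintype.card_fin] at h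
    omega
  have hle : U ≤ LinearMap.ker ψ := by
    intro b hb
    rw [LinearMap.mem_ker]
    funext i
    fin_cases i
    · simpa [hψ] using (h b hb).1
    · simpa [hψ] using (h b hb).2
  exact (Submodule.finrank_mono hle).trans hker.le

/-- **`P l` with witness `i` on a hyperplane**: if `dim A = 3`, `i ≠ l` and
`A ∩ {a_l = 0} ⊆ {a_i = 0}`, then `e_k ∈ A` for `k ∉ {i, l}`. [folklore] -/
theorem single_mem_of_P (A : Submodule K (Fin 4 → K)) (h3 : finrank K A = 3) {i l : Fin 4}
    (hil : i ≠ l) (hP : ∀ a ∈ A, a l = 0 → a i = 0) (k : Fin 4) (hki : k ≠ i) (hkl : k ≠ l) :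
    (Pi.single k 1 : Fin 4 → K) ∈ A := by
  classical
  let πl : (Fin 4 → K) →ₗ[K] K := LinearMap.proj l
  set Al : Submodule K (Fin 4 → K) := A ⊓ LinearMap.ker πl with hAl
  have memAl : ∀ a, a ∈ Al ↔ a ∈ A ∧ a l = 0 := fun a => by
    rw [hAl, Submodule.mem_inf, LinearMap.mem_ker]; rfl
  have hge : 2 ≤ finrank K Al := by
    have h := finrank_eq_finrank_map_add_finrank_inf_ker A πl
    have hb : finrank K (A.map πl) ≤ 1 := ((A.map πl).finrank_le).trans (Module.finrank_self K).le
    rw [hAl]; omega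
  have hvan : ∀ u ∈ Al, u l = 0 ∧ u i = 0 := fun u hu =>
    ⟨((memAl u).1 hu).2, hP u ((memAl u).1 hu).1 ((memAl u).1 hu).2⟩
  have hle : finrank K Al ≤ 2 := finrank_le_two_of_pair_vanish Al hil.symm hvan
  have h2 : finrank K Al = 2 := le_antisymm hle hge
  have hk : (Pi.single k 1 : Fin 4 → K) ∈ Al :=
    single_mem_of_le_pair Al h2 hil.symm hvan k hkl hki
  exact ((memAl _).1 hk).1

/-- **Three unit vectors in a proper subspace**: if `e_k ∈ A` for all `k ≠ m` and `A ≠ ⊤`, then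
`a_m = 0` on `A`. [folklore] -/
theorem coord_vanish_of_singles (A : Submodule K (Fin 4 → K)) (hA : A ≠ ⊤) {m : Fin 4}
    (hs : ∀ k, k ≠ m → (Pi.single k 1 : Fin 4 → K) ∈ A) : ∀ a ∈ A, a m = 0 := by
  classical
  by_contra hne
  push Not at hne
  obtain ⟨a, ha, ham⟩ := hne
  apply hA
  -- `e_m ∈ A`
  have hdec : ∀ v : Fin 4 → K, v = ∑ k, v k • (Pi.single k (1 : K) : Fin 4 → K) := fun v => by
    conv_lhs => rw [← Finset.univ_sum_single v]
    refine Finset.sum_congr rfl fun k _ => ?_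
    ext k'
    by_cases hk : k' = k
    · subst hk; simp
    · simp [hk]
  have hrest : ∀ v : Fin 4 → K, v m = 0 → v ∈ A := by
    intro v hvm
    rw [hdec v]
    refine Submodule.sum_mem _ fun k _ => ?_
    by_cases hk : k = m
    · rw [hk, hvm, zero_smul]; exact A.zero_mem
    · exact A.smul_mem _ (hs k hk)
  have hem : (Pi.single m 1 : Fin 4 → K) ∈ A := by
    have hv : a - a m • (Pi.single m 1 : Fin 4 → K) ∈ A := hrest _ (by simp)
    have : (Pi.single m 1 : Fin 4 → K) = (a m)⁻¹ • (a - (a - a m • Pi.single m 1)) := by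
      rw [sub_sub_cancel, smul_smul, inv_mul_cancel₀ ham, one_smul]
    rw [this]
    exact A.smul_mem _ (A.sub_mem ha hv)
  refine Submodule.eq_top_iff'.2 fun v => ?_
  rw [hdec v]
  refine Submodule.sum_mem _ fun k _ => A.smul_mem _ ?_
  by_cases hk : k = m
  · rw [hk]; exact hem
  · exact hs k hk

/-- A `3`-dimensional subspace of `K⁴` inside `{b_l = 0}` is `{b_l = 0}`: it contains `e_i`,
`i ≠ l`. [folklore] -/
theorem single_mem_of_coord_vanish (B : Submodule K (Fin 4 → K)) (h3 : finrank K B = 3)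
    {l : Fin 4} (hBl : ∀ b ∈ B, b l = 0) (i : Fin 4) (hil : i ≠ l) :
    (Pi.single i 1 : Fin 4 → K) ∈ B := by
  classical
  let πl : (Fin 4 → K) →ₗ[K] K := LinearMap.proj l
  have hsurj : Function.Surjective πl := fun c => ⟨Pi.single l c, by simp [πl]⟩
  have hker : finrank K (LinearMap.ker πl) = 3 := by
    have h := LinearMap.finrank_range_add_finrank_ker πl
    rw [LinearMap.range_eq_top.2 hsurj, finrank_top, Module.finrank_self,
      Module.finrank_fintype_fun_eq_card, Fintype.card_fin] at h
    omega
  have hle : B ≤ LinearMap.ker πl := fun b hb => by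
    rw [LinearMap.mem_ker]; exact hBl b hb
  have heq : B = LinearMap.ker πl := Submodule.eq_of_le_of_finrank_le hle (by rw [hker, h3])
  rw [heq, LinearMap.mem_ker]
  simp [πl, hil]

/-- From `Q j` on the three `j ≠ l` to `b_l ≡ 0` on a proper subspace `B` of dimension `3`.
[folklore] -/
theorem coord_vanish_of_Q (B : Submodule K (Fin 4 → K)) (hB : B ≠ ⊤) (h3 : finrank K B = 3)
    (l : Fin 4)
    (hQ : ∀ j, j ≠ l → ∃ i, i ≠ j ∧ ∀ b ∈ B, b j = 0 → b i = 0) :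
    ∀ b ∈ B, b l = 0 := by
  classical
  let S : Fin 4 → Bool := fun k => decide ((Pi.single k 1 : Fin 4 → K) ∈ B)
  have hS : ∀ k, ![S 0, S 1, S 2, S 3] k = S k := fun k => by fin_cases k <;> rfl
  have hSk : ∀ k, S k = true ↔ (Pi.single k 1 : Fin 4 → K) ∈ B := fun k => by
    simp [S]
  have hSk' : ∀ k, S k = false ↔ (Pi.single k 1 : Fin 4 → K) ∉ B := fun k => by
    simp [S]
  -- `S ≠ univ` since `B ≠ ⊤`
  have hex : ∃ k, ![S 0, S 1, S 2, S 3] k = false := by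
    by_contra hne
    push Not at hne
    apply hB
    have hall : ∀ k, (Pi.single k 1 : Fin 4 → K) ∈ B := fun k => by
      have h' := hne k
      rw [hS] at h'
      have h'' : S k = true := by revert h'; cases S k <;> simp
      exact (hSk k).1 h''
    refine Submodule.eq_top_iff'.2 fun v => ?_
    rw [← Finset.univ_sum_single v]
    refine Submodule.sum_mem _ fun k _ => ?_
    have : (Pi.single k (v k) : Fin 4 → K) = v k • Pi.single k 1 := by
      ext k'; by_cases hk : k' = k
      · subst hk; simp
      · simp [hk]
    rw [this]
    exact B.smul_mem _ (hall k)
  have hhyp : ∀ j, j ≠ l → ∃ i, i ≠ j ∧ ![S 0, S 1, S 2, S 3] i = false ∧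
      ∀ k, k ≠ i → k ≠ j → ![S 0, S 1, S 2, S 3] k = true := by
    intro j hjl
    obtain ⟨i, hij, hBi⟩ := hQ j hjl
    refine ⟨i, hij, ?_, fun k hki hkj => ?_⟩
    · rw [hS, hSk']
      intro hmem
      have := hBi _ hmem (by simp [hij])
      simp at this
    · rw [hS, hSk]
      exact single_mem_of_P B h3 hij hBi k hki hkj
  have hres := combQ l (S 0) (S 1) (S 2) (S 3) hex hhyp
  exact coord_vanish_of_singles B hB fun k hk => (hSk k).1 (by rw [← hS]; exact hres k hk)

/-- `P l` for ALL `l` is impossible on a proper subspace of dimension `3`. [folklore] -/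
theorem false_of_P_all (A : Submodule K (Fin 4 → K)) (hA : A ≠ ⊤) (h3 : finrank K A = 3)
    (hP : ∀ l, ∃ i, i ≠ l ∧ ∀ a ∈ A, a l = 0 → a i = 0) : False := by
  classical
  let S : Fin 4 → Bool := fun k => decide ((Pi.single k 1 : Fin 4 → K) ∈ A)
  have hS : ∀ k, ![S 0, S 1, S 2, S 3] k = S k := fun k => by fin_cases k <;> rfl
  have hSk : ∀ k, S k = true ↔ (Pi.single k 1 : Fin 4 → K) ∈ A := fun k => by
    simp [S]
  have hSk' : ∀ k, S k = false ↔ (Pi.single k 1 : Fin 4 → K) ∉ A := fun k => by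
    simp [S]
  have hex : ∃ k, ![S 0, S 1, S 2, S 3] k = false := by
    by_contra hne
    push Not at hne
    apply hA
    have hall : ∀ k, (Pi.single k 1 : Fin 4 → K) ∈ A := fun k => by
      have h' := hne k
      rw [hS] at h'
      have h'' : S k = true := by revert h'; cases S k <;> simp
      exact (hSk k).1 h''
    refine Submodule.eq_top_iff'.2 fun v => ?_
    rw [← Finset.univ_sum_single v]
    refine Submodule.sum_mem _ fun k _ => ?_
    have : (Pi.single k (v k) : Fin 4 → K) = v k • Pi.single k 1 := by
      ext k'; by_cases hk : k' = k
      · subst hk; simp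
      · simp [hk]
    rw [this]
    exact A.smul_mem _ (hall k)
  refine combP (S 0) (S 1) (S 2) (S 3) hex fun j => ?_
  obtain ⟨i, hij, hAi⟩ := hP j
  refine ⟨i, hij, ?_, fun k hki hkj => ?_⟩
  · rw [hS, hSk']
    intro hmem
    have := hAi _ hmem (by simp [hij])
    simp at this
  · rw [hS, hSk]
    exact single_mem_of_P A h3 hij hAi k hki hkj


end Summit.ValiantsHypothesis.ValiantsHypothesis.Theorems.SymPencilPerFourPairingDiscSixProductTools

end
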